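import Summits.BirchSwinnertonDyer.Rank1Residual.GaloisImage.FrobeniusOrderWitness
import Literature.NumberTheory.EllipticCurves.VariableChangePointsMap
import Literature.NumberTheory.EllipticCurves.MinimalModelReduction
import Literature.NumberTheory.EllipticCurves.LFunctionPrimeCoeff
import HarnessLib

/-!
# Cyclicity transfer (row T-B1 FILE 3): the records' currency `#(E₀ mod ℓ)(𝔽_ℓ)[p] ≤ p` forbids an
# arithmetic Frobenius at `ℓ` to fix `E[p]` — supplier (S2) of the binder `hne` of bridge (B1) at
# EVERY Kolyvagin level (cell `b2b-bsdres`, team n1011, ROUTE-1 (a′) chain; seat p09 GEN 4)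

HONEST FRAMING (cell `b2b-bsdres`, run/shared/lean/b2b/bsd-rank1-residual/, verbatim in every
file): the goal of the cell is to DELETE the COMBINATION-SHAPED residual classes of the
Birch–Swinnerton-Dyer formula for ALL analytic-rank `≤ 1` elliptic curves over `ℚ` — "full BSD
formula for every rank `≤ 1` curve in class `C`" assembled STRICTLY from published theorems — so
that the rank-`≤ 1` remainder becomes exactly the CONSTRUCTION-SHAPED classes, which are TYPED
(missing-input `Prop`s), NOT attempted. This is not "finishing BSD". Team n1011 (N10/N11, the
additive block `X4 ∧ p = 3`): research route; TOOL theorems only (no definition, no named fact);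
nothing here is a class theorem, no label changes, nothing is booked, no mark moves.

## What and why

Bridge (B1) of the (a′) chain (ROUTE-1 §25.4 (c); lead R5-53: membership theorem = p18's
`KolyvaginPrimeFrobeniusClass.lean`, inputs `TransvectionNormalForm` / `TransvectionGaloisInputs` and
this file = p09) turns an ℕ-currency Kolyvagin prime `ℓ` (`ℓ ≡ 1`, `a_ℓ ≡ 2 (mod p^m)`) into a
Sakamoto `τ`-class prime PROVIDED no arithmetic Frobenius at `ℓ` fixes `E[p]` pointwise (binder
`hne`; equivalently `E[p]^{Fr_ℓ} ≅ ℤ/p`, i.e. the `p`-part of `Ẽ(𝔽_ℓ)` is cyclic).  At Kolyvagin level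
`1` the binder follows from `p² ∤ #Ẽ(𝔽_ℓ)` (x11c's `sq_dvd_reductionPointCount_of_forall_smul_eq`),
but at level `m ≥ 2` one has `p^m ∣ #Ẽ(𝔽_ℓ)`, so the records certify cyclicity in the currency
`Nat.card {P : (E₀ mod ℓ)(𝔽_ℓ) // p • P = 0} ≤ p` on the reduction modulo `ℓ` of the GLOBAL minimal
model `E₀ = integralModelInt W` (p03's `card_torsion_le_of_intModel_of_card`, `X4ThreeKuriharaCertKernelPsi3`;
the `hcyc` binder of `X4/KuriharaLowerHalfSocket.lean`).  This file reads that currency: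

* `exists_ringEquiv_variableChange_reductionAt_map_eq` — the ADDITIVE form of the tree's card-only
  `natCard_point_reduction_minimal_baseChange`: `Ẽ_v.map e = D′ • (E₀ mod ℓ)` for a ring isomorphism
  `e : k_v ≃+* ℤ/ℓ` and a change of variables `D′` over `ℤ/ℓ` (Silverman VII.1.3(b): the two minimal
  equations over `K_v` differ by an `𝓞_v`-integral change of variables, which reduces);
* `exists_smul_ne_of_card_torsion_le` / `forall_exists_smul_ne_of_card_torsion_le` — **(S2): `hcyc`
  at a good `ℓ ≠ p` ⟹ no arithmetic Frobenius above `ℓ` fixes `E[p]`**: x11c's injective reduction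
  `E[p] →+ Ẽ_v(k_v)` (AEC VII.3.1(b) + "Frobenius-fixed ⟹ `k_v`-rational"; the construction of
  `sq_dvd_reductionPointCount_of_forall_smul_eq` is repeated verbatim up to that point — credit x11c),
  then the additive transport `Ẽ_v(k_v) ↪ Ẽ_v(ℤ/ℓ) = (D′ • E₀ mod ℓ)(ℤ/ℓ) ≃ (E₀ mod ℓ)(ℤ/ℓ)`
  (Mathlib `Affine.Point.map`, the tree's `Affine.Point.congrEquiv`, `VariableChange.pointEquiv`),
  landing in the `p`-torsion: `p² = #E[p] ≤ p`, absurd;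
* `forall_exists_smul_ne_of_intModel_of_card_torsion_le` — the same READ OFF AN INTEGER MODEL
  (`integralModelInt W = E₀`, `ℓ ∤ Δ(E₀)`), the literal shape of the cell's per-pair records.

References: J. H. Silverman, *AEC* 2nd ed. (2009) Prop. VII.1.3(b), VII.2.1, VII.3.1(b), VII.4.1(a),
Cor. III.6.4(b) [SilvermanAEC2009]; C.-H. Kim, AJM 148 (2026) §1.2.2 (cyclicity of `Ẽ(𝔽_ℓ)[p]` in
`𝒫_k`) [Kim2022StructureSelmer]; cell files ROUTE-1 §25.4 (c), `cells/n1011/skel/T-B1.md`.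
-/

noncomputable section

open scoped Classical
open NumberField IsDedekindDomain IsDedekindDomain.HeightOneSpectrum Field WeierstrassCurve
  Literature.NumberTheory.EllipticCurves Literature.NumberTheory.GaloisRepresentations
  Rat.HeightOneSpectrum

namespace Summit.BirchSwinnertonDyer.Rank1Residual.GaloisImage.KolyvaginPrime

universe u

/-- **The reduction of the local minimal model at `v ∣ ℓ`, mapped to `ZMod ℓ`, is an admissible change
of variables of the reduction modulo `ℓ` of the global minimal model** (`W/ℚ` globally minimal):
there are a ring isomorphism `e : k_v ≃+* ZMod ℓ` and `D' : VariableChange (ZMod ℓ)` with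
`(Ẽ_v).map e = D' • (E₀ mod ℓ)`, `E₀ = integralModelInt W`.  (The two minimal equations over `K_v`
differ by an `𝓞_v`-integral change of variables, Silverman VII.1.3(b)
(`exists_variableChange_baseChange_eq_of_isMinimal`), which reduces (`reduction_smul_eq_of_baseChange_eq`);
the global integral model is an integral model over `𝓞_v` (`integralModel_adicCompletion_eq`);
`k_v ≃ ℤ_ℓ/ℓ ≃ ℤ/ℓ` (`padicIntEquiv`, `PadicInt.residueField`).)  The additive form of the tree's
card-only `natCard_point_reduction_minimal_baseChange`. [cite: SilvermanAEC2009, Prop. VII.1.3(b), p. 186] -/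
theorem exists_ringEquiv_variableChange_reductionAt_map_eq (W : WeierstrassCurve ℚ) [W.IsElliptic]
    [W.IsGloballyMinimal] {ℓ : ℕ} [Fact ℓ.Prime] {v : HeightOneSpectrum (𝓞 ℚ)}
    (hv : (primesEquiv v : ℕ) = ℓ) :
    ∃ (e : IsLocalRing.ResidueField (v.adicCompletionIntegers ℚ) ≃+* ZMod ℓ)
      (D' : VariableChange (ZMod ℓ)),
      (W.reductionAt v).map (e : IsLocalRing.ResidueField (v.adicCompletionIntegers ℚ) →+* ZMod ℓ) =
        D' • (integralModelInt W).map (Int.castRingHom (ZMod ℓ)) := by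
  haveI := Fact.mk (primesEquiv v).2
  set O := v.adicCompletionIntegers ℚ with hO
  set X : WeierstrassCurve (v.adicCompletion ℚ) := W.baseChange (v.adicCompletion ℚ) with hX
  haveI hmin : IsMinimal O X := IsGloballyMinimal.isMinimal v
  have hΔ : X.Δ ≠ 0 := by
    rw [hX, baseChange, map_Δ]
    exact (map_ne_zero _).mpr W.isUnit_Δ.ne_zero
  -- the ring isomorphism `k_v ≃ ZMod ℓ`
  let e₀ : IsLocalRing.ResidueField O ≃+* ZMod (primesEquiv v : ℕ) :=
    (IsLocalRing.ResidueField.mapEquiv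
      (adicCompletionIntegers.padicIntEquiv v).toAlgEquiv.toRingEquiv).trans
      (PadicInt.residueField (p := (primesEquiv v : ℕ)))
  let e : IsLocalRing.ResidueField O ≃+* ZMod ℓ := e₀.trans (ZMod.ringEquivCongr hv)
  -- the two minimal models differ by an integral change of variables
  haveI h₀ : IsMinimal O ((X.exists_isMinimal O).choose • X) := (X.exists_isMinimal O).choose_spec
  obtain ⟨D, hD⟩ :=
    exists_variableChange_baseChange_eq_of_isMinimal (R := O) X (X.exists_isMinimal O).choose hΔ
  have hred : ((X.exists_isMinimal O).choose • X).reduction O =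
      D.map (IsLocalRing.residue O) • X.reduction O :=
    reduction_smul_eq_of_baseChange_eq X _ D hD
  have hXred : X.reduction O =
      (integralModelInt W).map ((IsLocalRing.residue O).comp (Int.castRingHom O)) := by
    rw [WeierstrassCurve.reduction, integralModel_adicCompletion_eq v W, map_map]
  have hWt : W.reductionAt v = D.map (IsLocalRing.residue O) •
      (integralModelInt W).map ((IsLocalRing.residue O).comp (Int.castRingHom O)) := by
    rw [← hXred, ← hred]
    rfl
  refine ⟨e, (D.map (IsLocalRing.residue O)).map (e : IsLocalRing.ResidueField O →+* ZMod ℓ), ?_⟩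
  rw [hWt, ← map_variableChange, map_map]
  exact congrArg _ (congrArg _ (RingHom.ext_int _ _))

/-- **Supplier (S2) of the binder `hne` of bridge (B1), ALL Kolyvagin levels.**  Let `W/ℚ` be a globally
minimal elliptic curve, `p ≠ ℓ` primes, `ℓ` of good reduction, `v` the place at `ℓ`.  If the
`p`-torsion of the reduction modulo `ℓ` of the global minimal model has at most `p` points — the
records' cyclicity currency `Nat.card {P : (E₀ mod ℓ)(𝔽_ℓ) // p • P = 0} ≤ p` (p03's
`card_torsion_le_of_intModel_of_card`, or one root of `Ψ₃`) — then NO arithmetic Frobenius at a prime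
above `v` fixes `E[p]` pointwise.  Proof: as in x11c's `sq_dvd_reductionPointCount_of_forall_smul_eq`
(whose construction is repeated here verbatim up to the injective `E[p] →+ Ẽ_v(k_v)`: reduction of
prime-to-`ℓ` torsion is injective, AEC VII.3.1(b), and a point fixed by Frobenius is `k_v`-rational),
followed by the ADDITIVE transport `Ẽ_v(k_v) ↪ Ẽ_v(ZMod ℓ) ≃ (D' • E₀ mod ℓ)(ZMod ℓ) ≃ (E₀ mod ℓ)(ZMod ℓ)`
(Mathlib `Affine.Point.map`, `exists_ringEquiv_variableChange_reductionAt_map_eq`, the tree's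
`VariableChange.pointEquiv`): an injective homomorphism `E[p] →+ (E₀ mod ℓ)(𝔽_ℓ)` lands in the
`p`-torsion, so `p² = #E[p] ≤ p`, absurd.
[cite: SilvermanAEC2009, Prop. VII.3.1(b) (PDF p. 170), Prop. VII.1.3(b), Cor. III.6.4(b)] -/
theorem exists_smul_ne_of_card_torsion_le (W : WeierstrassCurve ℚ) [W.IsElliptic]
    [W.IsGloballyMinimal] (p ℓ : ℕ) [Fact p.Prime] [Fact ℓ.Prime] (hℓp : ℓ ≠ p)
    (hgoodℓ : W.HasGoodReductionAtPrime ℓ) {v : HeightOneSpectrum (𝓞 ℚ)}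
    (hv : (ℓ : 𝓞 ℚ) ∈ v.asIdeal)
    (hcyc : Nat.card {P : ((integralModelInt W).map (Int.castRingHom (ZMod ℓ))).toAffine.Point //
      p • P = 0} ≤ p)
    {𝔓 : Ideal (absIntegers (𝓞 ℚ) ℚ)} (h𝔓 : 𝔓 ∈ v.primesAbove)
    {φ : absoluteGaloisGroup ℚ} (hφ : IsArithFrobAt (𝓞 ℚ) φ 𝔓) :
    ∃ P : W.geomTorsion p, φ • P ≠ P := by
  classical
  by_contra hcon
  push Not at hcon
  have hfix : ∀ P : W.geomTorsion p, φ • P = P := hcon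
  have hp : p.Prime := Fact.out
  have hℓ : ℓ.Prime := Fact.out
  -- Step 0: from the rational prime `ℓ` to the place `v`
  have hvℓ : (Rat.HeightOneSpectrum.primesEquiv v : ℕ) = ℓ := primesEquiv_eq_of_natCast_mem hℓ hv
  have hgood : W.HasGoodReductionAt v :=
    (hasGoodReductionAtPrime_primesEquiv_iff_holds W v ℓ hvℓ).mp hgoodℓ
  have hpv : (p : 𝓞 ℚ) ∉ v.asIdeal := fun h ↦
    hℓp (hvℓ.symm.trans (primesEquiv_eq_of_natCast_mem hp h))
  -- the reduction `Ẽ_v / k_v`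
  set k := IsLocalRing.ResidueField (v.adicCompletionIntegers ℚ) with hk
  set Wt : WeierstrassCurve k := W.reductionAt v with hWt
  haveI : Wt.IsElliptic := isElliptic_reductionAt hgood
  -- the reduction map on `p`-primary torsion along `ι`, for a local Frobenius `σ_v`
  obtain ⟨𝔐, h𝔐⟩ := v.localPrimesAbove_nonempty
  let ι : AlgebraicClosure ℚ →ₐ[ℚ] AlgebraicClosure (v.adicCompletion ℚ) :=
    closureEmb (K := ℚ) (v.adicCompletion ℚ)
  obtain ⟨σL, hσL⟩ := v.exists_isArithFrobAt_localAbsIntegers h𝔐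
  obtain ⟨φk, hφk⟩ := exists_frobenius_absoluteGaloisGroup k
  obtain ⟨f, hf, hfσ⟩ := exists_reduceTorsionHom hpv hgood h𝔐 ι hσL hφk
  set σ₀ : absoluteGaloisGroup ℚ := resGalOfEmb ι σL with hσ₀
  -- transport: `σ₀` also acts trivially on `E[p]`
  have h𝔓₀ : v.primeBelow ι 𝔐 ∈ v.primesAbove := primeBelow_mem_primesAbove h𝔐
  have hσ₀F : IsArithFrobAt (𝓞 ℚ) σ₀ (v.primeBelow ι 𝔐) := isArithFrobAt_resGalOfEmb h𝔐 ι hσL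
  obtain ⟨τ, hτ⟩ := exists_smul_eq_of_mem_primesAbove_holds h𝔓₀ h𝔓
  have hγ : IsArithFrobAt (𝓞 ℚ) (τ * σ₀ * τ⁻¹) 𝔓 := hτ ▸ hσ₀F.conj τ
  have hI : φ * (τ * σ₀ * τ⁻¹)⁻¹ ∈ 𝔓.inertia (absoluteGaloisGroup ℚ) := hφ.mul_inv_mem_inertia hγ
  have hfixpt : ∀ X : geomPoints W, p • X = 0 → φ • X = X := fun X hX ↦ by
    have := congrArg Subtype.val (hfix ⟨X, AddSubgroup.torsionBy.nsmul_iff.mpr hX⟩)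
    rwa [AddSubgroup.torsionBy.coe_smul] at this
  have hγfix : ∀ X : geomPoints W, p • X = 0 → (τ * σ₀ * τ⁻¹) • X = X := fun X hX ↦ by
    have h1 : (τ * σ₀ * τ⁻¹) • X = (φ * (τ * σ₀ * τ⁻¹)⁻¹)⁻¹ • (φ • X) := by
      rw [← mul_smul, mul_inv_rev, inv_inv, inv_mul_cancel_right]
    rw [h1, hfixpt X hX]
    exact W.smul_eq_of_mem_inertia_of_nsmul_eq_zero hgood hpv h𝔓 (inv_mem hI) hX
  have hσ₀fix : ∀ X : geomPoints W, p • X = 0 → σ₀ • X = X := fun X hX ↦ by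
    have hτX : p • (τ • X) = 0 := by rw [smul_comm, hX, smul_zero]
    have h1 := hγfix (τ • X) hτX
    rw [mul_smul, mul_smul, inv_smul_smul] at h1
    exact smul_left_cancel τ h1
  -- the injective homomorphism `E[p] → Ẽ_v(k_v)`
  let incl : W.geomTorsion p →+ W.geomPrimaryTorsion p :=
    { toFun := fun P ↦ ⟨P, 1, by
        have := AddSubgroup.torsionBy.nsmul_iff.mp P.2
        simpa only [pow_one] using this⟩
      map_zero' := rfl
      map_add' := fun _ _ ↦ rfl }
  have hincl : Function.Injective incl := fun P Q h ↦ by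
    apply Subtype.ext
    have := congrArg Subtype.val h
    exact this
  let g : W.geomTorsion p →+ geomPoints Wt := f.comp incl
  have hg : Function.Injective g := hf.comp hincl
  -- every `g P` is fixed by `φk`, hence `k_v`-rational
  have hgfix : ∀ P : W.geomTorsion p, φk • g P = g P := fun P ↦ by
    have hP : p • (P : geomPoints W) = 0 := AddSubgroup.torsionBy.nsmul_iff.mp P.2
    have h1 : σ₀ • incl P = incl P := by
      apply Subtype.ext
      rw [primaryComponent.coe_smul]
      exact hσ₀fix P hP
    show φk • f (incl P) = f (incl P)
    rw [← hfσ, h1]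
  let bc : (Wt.baseChange k).toAffine.Point →+ geomPoints Wt :=
    Affine.Point.baseChange k (AlgebraicClosure k)
  have hbc : Function.Injective bc := Affine.Point.map_injective _
  have hrange : ∀ P : W.geomTorsion p, g P ∈ bc.range := fun P ↦ by
    obtain ⟨R₀, hR₀⟩ := exists_baseChange_eq_of_frobenius_smul_eq Wt hφk (hgfix P)
    exact ⟨R₀, hR₀⟩
  let g' : W.geomTorsion p →+ bc.range := g.codRestrict bc.range hrange
  let eR : (Wt.baseChange k).toAffine.Point ≃+ bc.range := AddMonoidHom.ofInjective hbc
  let h : W.geomTorsion p →+ (Wt.baseChange k).toAffine.Point :=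
    eR.symm.toAddMonoidHom.comp g'
  have hh : Function.Injective h := by
    refine eR.symm.injective.comp ?_
    intro P Q hPQ
    exact hg (congrArg Subtype.val hPQ)
  -- THE MODEL TRANSFER `Ẽ_v(k_v) ↪ (E₀ mod ℓ)(ZMod ℓ)`, additively
  obtain ⟨e, D', hmodel⟩ := exists_ringEquiv_variableChange_reductionAt_map_eq W (ℓ := ℓ) hvℓ
  letI : Algebra k (ZMod ℓ) := (e : k →+* ZMod ℓ).toAlgebra
  set Eℓ : WeierstrassCurve (ZMod ℓ) := (integralModelInt W).map (Int.castRingHom (ZMod ℓ)) with hEℓ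
  have hmodel' : Wt.baseChange (ZMod ℓ) = D' • Eℓ := by
    rw [hWt, baseChange, RingHom.algebraMap_toAlgebra, hmodel]
  let T₁ : (Wt.baseChange k).toAffine.Point →+ (Wt.baseChange (ZMod ℓ)).toAffine.Point :=
    Affine.Point.map (W' := Wt) (Algebra.ofId k (ZMod ℓ))
  have hT₁ : Function.Injective T₁ := Affine.Point.map_injective _
  let T₂ : (Wt.baseChange (ZMod ℓ)).toAffine.Point ≃+ (D' • Eℓ).toAffine.Point :=
    Affine.Point.congrEquiv hmodel'
  let T₃ : (D' • Eℓ).toAffine.Point ≃+ Eℓ.toAffine.Point := (VariableChange.pointEquiv Eℓ D').symm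
  let gT : W.geomTorsion p →+ Eℓ.toAffine.Point :=
    T₃.toAddMonoidHom.comp (T₂.toAddMonoidHom.comp (T₁.comp h))
  have hgT : Function.Injective gT :=
    T₃.injective.comp (T₂.injective.comp (hT₁.comp hh))
  -- count: `E[p]` (of order `p²`) injects into the `p`-torsion of `(E₀ mod ℓ)(𝔽_ℓ)`
  haveI : NeZero ℓ := ⟨hℓ.ne_zero⟩
  let gS : W.geomTorsion p → {P : Eℓ.toAffine.Point // p • P = 0} := fun Q ↦
    ⟨gT Q, by
      have hQ : p • Q = 0 := by
        apply Subtype.ext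
        rw [AddSubgroup.coe_nsmul]
        exact AddSubgroup.torsionBy.nsmul_iff.mp Q.2
      rw [← map_nsmul, hQ, map_zero]⟩
  have hgS : Function.Injective gS := fun P Q hPQ ↦ hgT (congrArg Subtype.val hPQ)
  have hA : Nat.card (W.geomTorsion (p : ℕ)) = p ^ 2 :=
    card_torsionPoints_eq_sq_holds W (AlgebraicClosure ℚ) (n := p) (Nat.cast_ne_zero.mpr hp.ne_zero)
  have hle : p ^ 2 ≤ p := by
    rw [← hA]
    exact (Nat.card_le_card_of_injective gS hgS).trans hcyc
  have h2 : 2 ≤ p := hp.two_le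
  nlinarith

/-- **(S2) in the shape of the binder `hne` of `KolyvaginPrime.mem_frobeniusClassPrimes_of_frobenius`**
(place given by `primesEquiv v = ℓ`; quantified over all primes above `v` and all Frobenius elements).
[cite: SilvermanAEC2009, Prop. VII.3.1(b) (PDF p. 170), Cor. III.6.4(b)] -/
theorem forall_exists_smul_ne_of_card_torsion_le (W : WeierstrassCurve ℚ) [W.IsElliptic]
    [W.IsGloballyMinimal] (p : ℕ) {ℓ : ℕ} [Fact p.Prime] [Fact ℓ.Prime] (hℓp : ℓ ≠ p)
    (hgoodℓ : W.HasGoodReductionAtPrime ℓ) {v : HeightOneSpectrum (𝓞 ℚ)}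
    (hv : (primesEquiv v : ℕ) = ℓ)
    (hcyc : Nat.card {P : ((integralModelInt W).map (Int.castRingHom (ZMod ℓ))).toAffine.Point //
      p • P = 0} ≤ p) :
    ∀ 𝔓 ∈ v.primesAbove, ∀ φ : absoluteGaloisGroup ℚ, IsArithFrobAt (𝓞 ℚ) φ 𝔓 →
      ∃ P : W.geomTorsion p, φ • P ≠ P := by
  intro 𝔓 h𝔓 φ hφ
  have hvℓ : (ℓ : 𝓞 ℚ) ∈ v.asIdeal := by
    rw [DeuringLadic.natCast_mem_asIdeal_iff v ℓ, hv]
  exact exists_smul_ne_of_card_torsion_le W p ℓ hℓp hgoodℓ hvℓ hcyc h𝔓 hφ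

/-- **(S2) READ OFF AN INTEGER MODEL** (`integralModelInt W = E₀`, the records' literal shape):
`#(E₀ mod ℓ)(𝔽_ℓ)[p] ≤ p` for an explicit `E₀ : WeierstrassCurve ℤ`.
[cite: SilvermanAEC2009, Prop. VII.3.1(b) (PDF p. 170), Cor. III.6.4(b)] -/
theorem forall_exists_smul_ne_of_intModel_of_card_torsion_le (W : WeierstrassCurve ℚ) [W.IsElliptic]
    [W.IsGloballyMinimal] {E₀ : WeierstrassCurve ℤ} (hI : integralModelInt W = E₀)
    (p : ℕ) {ℓ : ℕ} [Fact p.Prime] [Fact ℓ.Prime] (hℓp : ℓ ≠ p) (hΔ : ¬ (ℓ : ℤ) ∣ E₀.Δ)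
    {v : HeightOneSpectrum (𝓞 ℚ)} (hv : (primesEquiv v : ℕ) = ℓ)
    (hcyc : Nat.card {P : (E₀.map (Int.castRingHom (ZMod ℓ))).toAffine.Point // p • P = 0} ≤ p) :
    ∀ 𝔓 ∈ v.primesAbove, ∀ φ : absoluteGaloisGroup ℚ, IsArithFrobAt (𝓞 ℚ) φ 𝔓 →
      ∃ P : W.geomTorsion p, φ • P ≠ P := by
  subst hI
  have hgood : W.HasGoodReductionAtPrime ℓ :=
    hasGoodReductionAtPrime_of_not_dvd W ℓ (by
      rw [Summit.BirchSwinnertonDyer.BirchSwinnertonDyer.Rank1Residual.IntModel.minimalDiscriminantInt_eq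
        rfl]; exact hΔ)
  exact forall_exists_smul_ne_of_card_torsion_le W p hℓp hgood hv hcyc

/-! ### Appendix (same seat, same day): the records' currency feeds p18's torsion-chain flag
`Nat.card (AddSubgroup.torsionBy (W.reductionAt v).toAffine.Point p) ≤ p` as well -/

/-- **An injective additive map `Ẽ_v(k_v) →+ (E₀ mod ℓ)(ℤ/ℓ)`** (`W/ℚ` globally minimal, `v ∣ ℓ`): the
chain `Ẽ_v(k_v) = (Ẽ_v ⊗ k_v)(k_v) ↪ (Ẽ_v ⊗_e ℤ/ℓ)(ℤ/ℓ) = (D′ • E₀ mod ℓ)(ℤ/ℓ) ≃ (E₀ mod ℓ)(ℤ/ℓ)` of the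
proof of `exists_smul_ne_of_card_torsion_le`, exported.  (It is in fact bijective — equal cardinalities,
`natCard_point_reduction_minimal_baseChange` — but injectivity is all the flag needs.)
[cite: SilvermanAEC2009, Prop. VII.1.3(b), p. 186] -/
theorem exists_addMonoidHom_reductionAt_intModel_injective (W : WeierstrassCurve ℚ) [W.IsElliptic]
    [W.IsGloballyMinimal] {ℓ : ℕ} [Fact ℓ.Prime] {v : HeightOneSpectrum (𝓞 ℚ)}
    (hv : (primesEquiv v : ℕ) = ℓ) :
    ∃ T : (W.reductionAt v).toAffine.Point →+
        ((integralModelInt W).map (Int.castRingHom (ZMod ℓ))).toAffine.Point,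
      Function.Injective T := by
  classical
  set k := IsLocalRing.ResidueField (v.adicCompletionIntegers ℚ) with hk
  set Wt : WeierstrassCurve k := W.reductionAt v with hWt
  obtain ⟨e, D', hmodel⟩ := exists_ringEquiv_variableChange_reductionAt_map_eq W (ℓ := ℓ) hv
  letI : Algebra k (ZMod ℓ) := (e : k →+* ZMod ℓ).toAlgebra
  set Eℓ : WeierstrassCurve (ZMod ℓ) := (integralModelInt W).map (Int.castRingHom (ZMod ℓ)) with hEℓ
  have hWtk : Wt = Wt.baseChange k := by
    rw [baseChange, Algebra.algebraMap_self, map_id]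
  have hmodel' : Wt.baseChange (ZMod ℓ) = D' • Eℓ := by
    rw [hWt, baseChange, RingHom.algebraMap_toAlgebra, hmodel]
  let T₀ : Wt.toAffine.Point ≃+ (Wt.baseChange k).toAffine.Point := Affine.Point.congrEquiv hWtk
  let T₁ : (Wt.baseChange k).toAffine.Point →+ (Wt.baseChange (ZMod ℓ)).toAffine.Point :=
    Affine.Point.map (W' := Wt) (Algebra.ofId k (ZMod ℓ))
  have hT₁ : Function.Injective T₁ := Affine.Point.map_injective _
  let T₂ : (Wt.baseChange (ZMod ℓ)).toAffine.Point ≃+ (D' • Eℓ).toAffine.Point :=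
    Affine.Point.congrEquiv hmodel'
  let T₃ : (D' • Eℓ).toAffine.Point ≃+ Eℓ.toAffine.Point := (VariableChange.pointEquiv Eℓ D').symm
  exact ⟨T₃.toAddMonoidHom.comp (T₂.toAddMonoidHom.comp (T₁.comp T₀.toAddMonoidHom)),
    T₃.injective.comp (T₂.injective.comp (hT₁.comp T₀.injective))⟩

/-- **The records' cyclicity currency gives p18's flag**: `#(E₀ mod ℓ)(𝔽_ℓ)[p] ≤ p` (reduction modulo `ℓ`
of the GLOBAL minimal model, subtype spelling of `X4/KuriharaLowerHalfSocket`'s `hcyc`) implies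
`Nat.card (AddSubgroup.torsionBy (W.reductionAt v).toAffine.Point p) ≤ p` (the `hflag` of p18's
`FrobShape.exists_frobenius_kernel_data`, local-minimal-model currency) — an injective additive map
restricts to an injection of `p`-torsion. [cite: SilvermanAEC2009, Prop. VII.1.3(b), p. 186] -/
theorem natCard_torsionBy_reductionAt_le_of_card_torsion_le (W : WeierstrassCurve ℚ) [W.IsElliptic]
    [W.IsGloballyMinimal] (p : ℕ) {ℓ : ℕ} [Fact ℓ.Prime] {v : HeightOneSpectrum (𝓞 ℚ)}
    (hv : (primesEquiv v : ℕ) = ℓ)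
    (hcyc : Nat.card {P : ((integralModelInt W).map (Int.castRingHom (ZMod ℓ))).toAffine.Point //
      p • P = 0} ≤ p) :
    Nat.card (AddSubgroup.torsionBy (W.reductionAt v).toAffine.Point (p : ℕ)) ≤ p := by
  have hℓ : ℓ.Prime := Fact.out
  haveI : NeZero ℓ := ⟨hℓ.ne_zero⟩
  obtain ⟨T, hT⟩ := exists_addMonoidHom_reductionAt_intModel_injective W (ℓ := ℓ) hv
  let g : AddSubgroup.torsionBy (W.reductionAt v).toAffine.Point (p : ℕ) →
      {P : ((integralModelInt W).map (Int.castRingHom (ZMod ℓ))).toAffine.Point // p • P = 0} :=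
    fun Q ↦ ⟨T Q, by
      rw [← map_nsmul, AddSubgroup.torsionBy.nsmul_iff.mp Q.2, map_zero]⟩
  have hg : Function.Injective g := fun P Q hPQ ↦
    Subtype.ext (hT (congrArg Subtype.val hPQ))
  exact (Nat.card_le_card_of_injective g hg).trans hcyc

end Summit.BirchSwinnertonDyer.Rank1Residual.GaloisImage.KolyvaginPrime

end
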